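import Summits.KontsevichZagierPeriods.KontsevichZagierPeriods.Theorems.UnfoldedLogStokes.Negative.LoadBearing

/-!
# `LiouvilleUnfolding.UnfoldedLogStokes` (stmt-KontsevichZagierPeriods-2835) — load-bearing hypotheses II

Continuation of `Negative/LoadBearing.lean`: ANY proof of the crux must also use the continuity of
`t ↦ H (x,t)` on the CLOSED fibre (`unfoldedLogStokes_false_without_contH` — witness D: a step of `H` at
`t = b`, `V = 1 + t`), the clause `HasDerivAt (t ↦ H (x,t)) (H' (x,t))`
(`unfoldedLogStokes_false_without_derivH` — witness E: `H = t` but `H' := 0`; without the clause `H'` is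
a free symbol and the bulk term `r₁ = [{1 ≤ u ≤ V}, H'/u]` decouples) and the clause
`HasDerivAt (t ↦ V (x,t)) (V' (x,t))` (`unfoldedLogStokes_false_without_derivV` — witness F: `V = 1 + t`
but `V' := 0`; `r₄ = [band, H V'/V]` decouples).  Each witness is honest in every other clause; the
boundary term `r₂ = [[1,2], 1/u] = log 2 ≥ 1/2` is what fails to cancel.
[Kontsevich–Zagier 2001, §1.2] [folklore]
-/

noncomputable section

open Set MeasureTheory MvPolynomial Filter Topology
open Literature.NumberTheory.Transcendental Literature.ModelTheory.ExponentialFields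
open Literature.NumberTheory.Transcendental.SemialgebraicDerivative (sa_atom)
open Summit.KontsevichZagierPeriods.KontsevichZagierPeriods.Theses.LiouvilleUnfolding (UnfoldedLogStokes)

namespace Summit.KontsevichZagierPeriods.LiouvilleUnfolding.UnfoldedLogStokesNegative

/-! ### §2d continuity of `H` on the CLOSED fibre is load-bearing
Witness D: `[a,b] = [0,1]`, `H = 0` on `[0,1)`, `H(1) = 1` (step), `H' = 0`, `V = 1 + t`, `V' = 1`:
`r₁ = r₃ = r₄ = 0` (on the OPEN fibre `H V'/V = 0`), `r₂ = [{1 ≤ u ≤ 2}, H(1)/u] = log 2`. -/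

/-- The crux with the continuity of `t ↦ H (x,t)` on `[a x, b x]` DELETED (continuity of `V` kept). -/
def WithoutContH : Prop :=
  ∀ (n : ℕ) (τ : Set (Fin n → ℝ)) (a b : (Fin n → ℝ) → ℝ) (H H' V V' : (Fin (n + 1) → ℝ) → ℝ) (r₁ : Literature.NumberTheory.Transcendental.KZ.IntegralRep (n + 2)) (r₂ r₃ r₄ : Literature.NumberTheory.Transcendental.KZ.IntegralRep (n + 1)), Literature.ModelTheory.ExponentialFields.IsSemialgebraic ℚ τ →
    Literature.NumberTheory.Transcendental.IsSemialgebraicFunOn ℚ τ a →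
    Literature.NumberTheory.Transcendental.IsSemialgebraicFunOn ℚ τ b →
    (∀ x ∈ τ, a x ≤ b x) →
    r₄.domain = {z | (Fin.init z : Fin n → ℝ) ∈ τ ∧ a (Fin.init z) ≤ z (Fin.last n) ∧ z (Fin.last n) ≤ b (Fin.init z)} →
    Literature.NumberTheory.Transcendental.IsSemialgebraicFunOn ℚ r₄.domain H →
    Literature.NumberTheory.Transcendental.IsSemialgebraicFunOn ℚ r₄.domain V →
    (∀ z ∈ r₄.domain, 1 ≤ V z) →
    (∀ x ∈ τ, ContinuousOn (fun t : ℝ => V (Fin.snoc x t)) (Set.Icc (a x) (b x))) →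
    (∀ x ∈ τ, ∀ t ∈ Set.Ioo (a x) (b x), HasDerivAt (fun s : ℝ => H (Fin.snoc x s)) (H' (Fin.snoc x t)) t ∧ HasDerivAt (fun s : ℝ => V (Fin.snoc x s)) (V' (Fin.snoc x t)) t) →
    (∀ z ∈ r₄.domain, a (Fin.init z) < z (Fin.last n) → z (Fin.last n) < b (Fin.init z) → r₄.integrand z = H z * V' z / V z) →
    r₁.domain = {w | (Fin.init w : Fin (n + 1) → ℝ) ∈ r₄.domain ∧ 1 ≤ w (Fin.last (n + 1)) ∧ w (Fin.last (n + 1)) ≤ V (Fin.init w)} →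
    (∀ w ∈ r₁.domain, a (Fin.init (Fin.init w)) < Fin.init w (Fin.last n) → Fin.init w (Fin.last n) < b (Fin.init (Fin.init w)) → r₁.integrand w = H' (Fin.init w) / w (Fin.last (n + 1))) →
    r₂.domain = {z | (Fin.init z : Fin n → ℝ) ∈ τ ∧ 1 ≤ z (Fin.last n) ∧ z (Fin.last n) ≤ V (Fin.snoc (Fin.init z) (b (Fin.init z)))} →
    (∀ z ∈ r₂.domain, r₂.integrand z = H (Fin.snoc (Fin.init z) (b (Fin.init z))) / z (Fin.last n)) →
    r₃.domain = {z | (Fin.init z : Fin n → ℝ) ∈ τ ∧ 1 ≤ z (Fin.last n) ∧ z (Fin.last n) ≤ V (Fin.snoc (Fin.init z) (a (Fin.init z)))} →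
    (∀ z ∈ r₃.domain, r₃.integrand z = H (Fin.snoc (Fin.init z) (a (Fin.init z))) / z (Fin.last n)) →
    Literature.NumberTheory.Transcendental.KZ.of r₁ - Literature.NumberTheory.Transcendental.KZ.of r₂ + Literature.NumberTheory.Transcendental.KZ.of r₃ + Literature.NumberTheory.Transcendental.KZ.of r₄ ∈ Literature.NumberTheory.Transcendental.KZ.relations

namespace D

/-- The representation `r₄ = [band, H V'/V]` of this witness (honest). [folklore] -/
def r₄ : KZ.IntegralRep 1 := zeroRep (I 0 1) sa_I01
/-- The representation `r₁ = [{1 ≤ u ≤ V}, H'/u]` of this witness (honest). [folklore] -/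
def r₁ : KZ.IntegralRep 2 := r1zero (I 0 1) sa_I01 Vlin (sa_Vlin sa_I01)
/-- `r₂ = [{1 ≤ u ≤ V(1) = 2}, H(1)/u = 1/u]`, value `log 2`. -/
def r₂ : KZ.IntegralRep 1 :=
  invRep (Bdry Vlin 1) (sa_Bdry Vlin_snoc_one (sa_two sa_τ₀)) (Bdry_subset_I12 Vlin_snoc_one le_rfl)
/-- `r₃ = [{1 ≤ u ≤ V(0) = 1}, H(0)/u = 0]`. -/
def r₃ : KZ.IntegralRep 1 := zeroRep (Bdry Vlin 0) (sa_Bdry Vlin_snoc_zero (sa_one sa_τ₀))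

end D

/-- **Continuity of `H` up to the fibre boundary is load-bearing** (witness D). -/
theorem unfoldedLogStokes_false_without_contH : ¬ WithoutContH := by
  intro h
  have hV1 : ∀ z ∈ D.r₄.domain, 1 ≤ Vlin z := fun z hz => by
    have h1 := (mem_I.1 hz).1
    simp only [Vlin_apply]
    linarith
  have hcont : ∀ x ∈ τ₀, ContinuousOn (fun t : ℝ => Vlin (Fin.snoc x t)) (Icc 0 1) := fun x _ =>
    continuousOn_Vlin x _
  have hder : ∀ x ∈ τ₀, ∀ t ∈ Ioo (0 : ℝ) 1,
      HasDerivAt (fun s : ℝ => step 0 1 (Fin.snoc x s)) 0 t ∧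
        HasDerivAt (fun s : ℝ => Vlin (Fin.snoc x s)) 1 t := fun x _ t ht =>
    ⟨hasDerivAt_step 0 1 ht.2 x, hasDerivAt_Vlin t x⟩
  have hr₄ : ∀ z ∈ D.r₄.domain, (0 : ℝ) < z 0 → z 0 < 1 →
      D.r₄.integrand z = step 0 1 z * 1 / Vlin z := fun z _ _ h2 => by
    simp [D.r₄, step_of_lt h2]
  have hr₁ : ∀ w ∈ D.r₁.domain, (0 : ℝ) < Fin.init w 0 → Fin.init w 0 < 1 →
      D.r₁.integrand w = 0 / w (Fin.last 1) := fun w _ _ _ => by simp [D.r₁, r1zero]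
  have hr₂ : ∀ z ∈ D.r₂.domain, D.r₂.integrand z = step 0 1 (Fin.snoc (Fin.init z) 1) / z 0 :=
    fun z _ => by rw [step_snoc_one]; simp [D.r₂]
  have hr₃ : ∀ z ∈ D.r₃.domain, D.r₃.integrand z = step 0 1 (Fin.snoc (Fin.init z) 0) / z 0 :=
    fun z _ => by rw [step_snoc_zero]; simp [D.r₃]
  have key := h 0 τ₀ (fun _ => 0) (fun _ => 1) (step 0 1) (fun _ => 0) Vlin (fun _ => 1)
    D.r₁ D.r₂ D.r₃ D.r₄ sa_τ₀ (sa_zero sa_τ₀) (sa_one sa_τ₀) (fun _ _ => zero_le_one) rfl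
    (sa_step (sa_zero sa_I01) (sa_one sa_I01)) (sa_Vlin sa_I01) hV1 hcont hder hr₄ rfl hr₁ rfl hr₂
    rfl hr₃
  have hval := values_of_mem_relations _ _ _ _ key
  have h2 : 1 / 2 ≤ D.r₂.value := half_le_value_invRep _ _ (Bdry_eq_I Vlin_snoc_one)
  simp only [D.r₁, D.r₃, D.r₄, r1zero, value_zeroRep] at hval
  linarith

/-! ### §2e the derivative hypothesis for `H` is load-bearing (`H'` is otherwise a free symbol)
Witness E: `[0,1]`, `H = t`, but `H' := 0`; `V = 2`, `V' = 0`: `r₁ = r₃ = r₄ = 0`,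
`r₂ = [{1 ≤ u ≤ 2}, H(1)/u] = log 2`. -/

/-- The crux with `HasDerivAt (t ↦ H (x,t)) (H' (x,t)) t` DELETED (the `V`-clause kept). -/
def WithoutDerivH : Prop :=
  ∀ (n : ℕ) (τ : Set (Fin n → ℝ)) (a b : (Fin n → ℝ) → ℝ) (H H' V V' : (Fin (n + 1) → ℝ) → ℝ) (r₁ : Literature.NumberTheory.Transcendental.KZ.IntegralRep (n + 2)) (r₂ r₃ r₄ : Literature.NumberTheory.Transcendental.KZ.IntegralRep (n + 1)), Literature.ModelTheory.ExponentialFields.IsSemialgebraic ℚ τ →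
    Literature.NumberTheory.Transcendental.IsSemialgebraicFunOn ℚ τ a →
    Literature.NumberTheory.Transcendental.IsSemialgebraicFunOn ℚ τ b →
    (∀ x ∈ τ, a x ≤ b x) →
    r₄.domain = {z | (Fin.init z : Fin n → ℝ) ∈ τ ∧ a (Fin.init z) ≤ z (Fin.last n) ∧ z (Fin.last n) ≤ b (Fin.init z)} →
    Literature.NumberTheory.Transcendental.IsSemialgebraicFunOn ℚ r₄.domain H →
    Literature.NumberTheory.Transcendental.IsSemialgebraicFunOn ℚ r₄.domain V →
    (∀ z ∈ r₄.domain, 1 ≤ V z) →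
    (∀ x ∈ τ, ContinuousOn (fun t : ℝ => H (Fin.snoc x t)) (Set.Icc (a x) (b x)) ∧ ContinuousOn (fun t : ℝ => V (Fin.snoc x t)) (Set.Icc (a x) (b x))) →
    (∀ x ∈ τ, ∀ t ∈ Set.Ioo (a x) (b x), HasDerivAt (fun s : ℝ => V (Fin.snoc x s)) (V' (Fin.snoc x t)) t) →
    (∀ z ∈ r₄.domain, a (Fin.init z) < z (Fin.last n) → z (Fin.last n) < b (Fin.init z) → r₄.integrand z = H z * V' z / V z) →
    r₁.domain = {w | (Fin.init w : Fin (n + 1) → ℝ) ∈ r₄.domain ∧ 1 ≤ w (Fin.last (n + 1)) ∧ w (Fin.last (n + 1)) ≤ V (Fin.init w)} →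
    (∀ w ∈ r₁.domain, a (Fin.init (Fin.init w)) < Fin.init w (Fin.last n) → Fin.init w (Fin.last n) < b (Fin.init (Fin.init w)) → r₁.integrand w = H' (Fin.init w) / w (Fin.last (n + 1))) →
    r₂.domain = {z | (Fin.init z : Fin n → ℝ) ∈ τ ∧ 1 ≤ z (Fin.last n) ∧ z (Fin.last n) ≤ V (Fin.snoc (Fin.init z) (b (Fin.init z)))} →
    (∀ z ∈ r₂.domain, r₂.integrand z = H (Fin.snoc (Fin.init z) (b (Fin.init z))) / z (Fin.last n)) →
    r₃.domain = {z | (Fin.init z : Fin n → ℝ) ∈ τ ∧ 1 ≤ z (Fin.last n) ∧ z (Fin.last n) ≤ V (Fin.snoc (Fin.init z) (a (Fin.init z)))} →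
    (∀ z ∈ r₃.domain, r₃.integrand z = H (Fin.snoc (Fin.init z) (a (Fin.init z))) / z (Fin.last n)) →
    Literature.NumberTheory.Transcendental.KZ.of r₁ - Literature.NumberTheory.Transcendental.KZ.of r₂ + Literature.NumberTheory.Transcendental.KZ.of r₃ + Literature.NumberTheory.Transcendental.KZ.of r₄ ∈ Literature.NumberTheory.Transcendental.KZ.relations

namespace E

/-- The representation `r₄ = [band, H V'/V]` of this witness (honest). [folklore] -/
def r₄ : KZ.IntegralRep 1 := zeroRep (I 0 1) sa_I01
/-- The representation `r₁ = [{1 ≤ u ≤ V}, H'/u]` of this witness (honest). [folklore] -/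
def r₁ : KZ.IntegralRep 2 := r1zero (I 0 1) sa_I01 (fun _ => 2) (sa_two sa_I01)
/-- The representation `r₂ = [{1 ≤ u ≤ V(b)}, H(b)/u]` of this witness (honest). [folklore] -/
def r₂ : KZ.IntegralRep 1 :=
  invRep (Bdry (fun _ => 2) 1) (sa_Bdry (const_snoc 1 2) (sa_two sa_τ₀))
    (Bdry_subset_I12 (const_snoc 1 2) le_rfl)
/-- The representation `r₃ = [{1 ≤ u ≤ V(a)}, H(a)/u]` of this witness (honest). [folklore] -/
def r₃ : KZ.IntegralRep 1 := zeroRep (Bdry (fun _ => 2) 0) (sa_Bdry (const_snoc 0 2) (sa_two sa_τ₀))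

end E

/-- **The `H`-derivative clause is load-bearing** (witness E). -/
theorem unfoldedLogStokes_false_without_derivH : ¬ WithoutDerivH := by
  intro h
  have hcont : ∀ x ∈ τ₀, ContinuousOn (fun t : ℝ => Hcoord (Fin.snoc x t)) (Icc 0 1) ∧
      ContinuousOn (fun _ : ℝ => (2 : ℝ)) (Icc 0 1) := fun x _ =>
    ⟨continuousOn_Hcoord x _, continuousOn_const⟩
  have hder : ∀ x ∈ τ₀, ∀ t ∈ Ioo (0 : ℝ) 1, HasDerivAt (fun _ : ℝ => (2 : ℝ)) 0 t :=
    fun x _ t _ => hasDerivAt_const t 2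
  have hr₄ : ∀ z ∈ E.r₄.domain, (0 : ℝ) < z 0 → z 0 < 1 →
      E.r₄.integrand z = Hcoord z * 0 / 2 := fun z _ _ _ => by simp [E.r₄]
  have hr₁ : ∀ w ∈ E.r₁.domain, (0 : ℝ) < Fin.init w 0 → Fin.init w 0 < 1 →
      E.r₁.integrand w = 0 / w (Fin.last 1) := fun w _ _ _ => by simp [E.r₁, r1zero]
  have hr₂ : ∀ z ∈ E.r₂.domain, E.r₂.integrand z = Hcoord (Fin.snoc (Fin.init z) 1) / z 0 :=
    fun z _ => by simp [E.r₂]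
  have hr₃ : ∀ z ∈ E.r₃.domain, E.r₃.integrand z = Hcoord (Fin.snoc (Fin.init z) 0) / z 0 :=
    fun z _ => by simp [E.r₃]
  have key := h 0 τ₀ (fun _ => 0) (fun _ => 1) Hcoord (fun _ => 0) (fun _ => 2) (fun _ => 0)
    E.r₁ E.r₂ E.r₃ E.r₄ sa_τ₀ (sa_zero sa_τ₀) (sa_one sa_τ₀) (fun _ _ => zero_le_one) rfl
    (sa_Hcoord sa_I01) (sa_two sa_I01) (fun z _ => by norm_num) hcont hder hr₄ rfl hr₁ rfl hr₂
    rfl hr₃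
  have hval := values_of_mem_relations _ _ _ _ key
  have h2 : 1 / 2 ≤ E.r₂.value := half_le_value_invRep _ _ (Bdry_eq_I (const_snoc 1 2))
  simp only [E.r₁, E.r₃, E.r₄, r1zero, value_zeroRep] at hval
  linarith

/-! ### §2f the derivative hypothesis for `V` is load-bearing (`V'` is otherwise a free symbol)
Witness F: `[0,1]`, `H = 1`, `H' = 0`, `V = 1 + t` but `V' := 0`: `r₁ = r₃ = r₄ = 0`,
`r₂ = [{1 ≤ u ≤ 2}, 1/u] = log 2`. -/

/-- The crux with `HasDerivAt (t ↦ V (x,t)) (V' (x,t)) t` DELETED (the `H`-clause kept). -/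
def WithoutDerivV : Prop :=
  ∀ (n : ℕ) (τ : Set (Fin n → ℝ)) (a b : (Fin n → ℝ) → ℝ) (H H' V V' : (Fin (n + 1) → ℝ) → ℝ) (r₁ : Literature.NumberTheory.Transcendental.KZ.IntegralRep (n + 2)) (r₂ r₃ r₄ : Literature.NumberTheory.Transcendental.KZ.IntegralRep (n + 1)), Literature.ModelTheory.ExponentialFields.IsSemialgebraic ℚ τ →
    Literature.NumberTheory.Transcendental.IsSemialgebraicFunOn ℚ τ a →
    Literature.NumberTheory.Transcendental.IsSemialgebraicFunOn ℚ τ b →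
    (∀ x ∈ τ, a x ≤ b x) →
    r₄.domain = {z | (Fin.init z : Fin n → ℝ) ∈ τ ∧ a (Fin.init z) ≤ z (Fin.last n) ∧ z (Fin.last n) ≤ b (Fin.init z)} →
    Literature.NumberTheory.Transcendental.IsSemialgebraicFunOn ℚ r₄.domain H →
    Literature.NumberTheory.Transcendental.IsSemialgebraicFunOn ℚ r₄.domain V →
    (∀ z ∈ r₄.domain, 1 ≤ V z) →
    (∀ x ∈ τ, ContinuousOn (fun t : ℝ => H (Fin.snoc x t)) (Set.Icc (a x) (b x)) ∧ ContinuousOn (fun t : ℝ => V (Fin.snoc x t)) (Set.Icc (a x) (b x))) →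
    (∀ x ∈ τ, ∀ t ∈ Set.Ioo (a x) (b x), HasDerivAt (fun s : ℝ => H (Fin.snoc x s)) (H' (Fin.snoc x t)) t) →
    (∀ z ∈ r₄.domain, a (Fin.init z) < z (Fin.last n) → z (Fin.last n) < b (Fin.init z) → r₄.integrand z = H z * V' z / V z) →
    r₁.domain = {w | (Fin.init w : Fin (n + 1) → ℝ) ∈ r₄.domain ∧ 1 ≤ w (Fin.last (n + 1)) ∧ w (Fin.last (n + 1)) ≤ V (Fin.init w)} →
    (∀ w ∈ r₁.domain, a (Fin.init (Fin.init w)) < Fin.init w (Fin.last n) → Fin.init w (Fin.last n) < b (Fin.init (Fin.init w)) → r₁.integrand w = H' (Fin.init w) / w (Fin.last (n + 1))) →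
    r₂.domain = {z | (Fin.init z : Fin n → ℝ) ∈ τ ∧ 1 ≤ z (Fin.last n) ∧ z (Fin.last n) ≤ V (Fin.snoc (Fin.init z) (b (Fin.init z)))} →
    (∀ z ∈ r₂.domain, r₂.integrand z = H (Fin.snoc (Fin.init z) (b (Fin.init z))) / z (Fin.last n)) →
    r₃.domain = {z | (Fin.init z : Fin n → ℝ) ∈ τ ∧ 1 ≤ z (Fin.last n) ∧ z (Fin.last n) ≤ V (Fin.snoc (Fin.init z) (a (Fin.init z)))} →
    (∀ z ∈ r₃.domain, r₃.integrand z = H (Fin.snoc (Fin.init z) (a (Fin.init z))) / z (Fin.last n)) →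
    Literature.NumberTheory.Transcendental.KZ.of r₁ - Literature.NumberTheory.Transcendental.KZ.of r₂ + Literature.NumberTheory.Transcendental.KZ.of r₃ + Literature.NumberTheory.Transcendental.KZ.of r₄ ∈ Literature.NumberTheory.Transcendental.KZ.relations

namespace F

/-- The representation `r₄ = [band, H V'/V]` of this witness (honest). [folklore] -/
def r₄ : KZ.IntegralRep 1 := zeroRep (I 0 1) sa_I01
/-- The representation `r₁ = [{1 ≤ u ≤ V}, H'/u]` of this witness (honest). [folklore] -/
def r₁ : KZ.IntegralRep 2 := r1zero (I 0 1) sa_I01 Vlin (sa_Vlin sa_I01)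
/-- `r₂ = [{1 ≤ u ≤ V(1) = 2}, 1/u]`, value `log 2`. -/
def r₂ : KZ.IntegralRep 1 :=
  invRep (Bdry Vlin 1) (sa_Bdry Vlin_snoc_one (sa_two sa_τ₀)) (Bdry_subset_I12 Vlin_snoc_one le_rfl)
/-- `r₃ = [{1 ≤ u ≤ V(0) = 1}, 1/u]` (null). -/
def r₃ : KZ.IntegralRep 1 :=
  invRep (Bdry Vlin 0) (sa_Bdry Vlin_snoc_zero (sa_one sa_τ₀)) (Bdry_subset_I12 Vlin_snoc_zero one_le_two)

/-- This boundary representation has null domain, value `0`. [folklore] -/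
theorem value_r₃ : r₃.value = 0 :=
  value_invRep_of_null _ _ (by rw [Bdry_eq_I Vlin_snoc_zero]; exact volume_I_eq_zero le_rfl)
/-- `[[1,2], 1/u] ≥ 1/2` (it is `log 2`). [folklore] -/
theorem half_le_value_r₂ : 1 / 2 ≤ r₂.value := half_le_value_invRep _ _ (Bdry_eq_I Vlin_snoc_one)

end F

/-- **The `V`-derivative clause is load-bearing** (witness F). -/
theorem unfoldedLogStokes_false_without_derivV : ¬ WithoutDerivV := by
  intro h
  have hV1 : ∀ z ∈ F.r₄.domain, 1 ≤ Vlin z := fun z hz => by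
    have h1 := (mem_I.1 hz).1
    simp only [Vlin_apply]
    linarith
  have hcont : ∀ x ∈ τ₀, ContinuousOn (fun _ : ℝ => (1 : ℝ)) (Icc 0 1) ∧
      ContinuousOn (fun t : ℝ => Vlin (Fin.snoc x t)) (Icc 0 1) := fun x _ =>
    ⟨continuousOn_const, continuousOn_Vlin x _⟩
  have hder : ∀ x ∈ τ₀, ∀ t ∈ Ioo (0 : ℝ) 1, HasDerivAt (fun _ : ℝ => (1 : ℝ)) 0 t :=
    fun x _ t _ => hasDerivAt_const t 1
  have hr₄ : ∀ z ∈ F.r₄.domain, (0 : ℝ) < z 0 → z 0 < 1 →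
      F.r₄.integrand z = 1 * 0 / Vlin z := fun z _ _ _ => by simp [F.r₄]
  have hr₁ : ∀ w ∈ F.r₁.domain, (0 : ℝ) < Fin.init w 0 → Fin.init w 0 < 1 →
      F.r₁.integrand w = 0 / w (Fin.last 1) := fun w _ _ _ => by simp [F.r₁, r1zero]
  have hr₂ : ∀ z ∈ F.r₂.domain, F.r₂.integrand z = 1 / z 0 := fun z _ => by simp [F.r₂]
  have hr₃ : ∀ z ∈ F.r₃.domain, F.r₃.integrand z = 1 / z 0 := fun z _ => by simp [F.r₃]
  have key := h 0 τ₀ (fun _ => 0) (fun _ => 1) (fun _ => 1) (fun _ => 0) Vlin (fun _ => 0)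
    F.r₁ F.r₂ F.r₃ F.r₄ sa_τ₀ (sa_zero sa_τ₀) (sa_one sa_τ₀) (fun _ _ => zero_le_one) rfl
    (sa_one sa_I01) (sa_Vlin sa_I01) hV1 hcont hder hr₄ rfl hr₁ rfl hr₂ rfl hr₃
  have hval := values_of_mem_relations _ _ _ _ key
  have h2 := F.half_le_value_r₂
  rw [F.value_r₃] at hval
  simp only [F.r₁, F.r₄, r1zero, value_zeroRep] at hval
  linarith


end Summit.KontsevichZagierPeriods.LiouvilleUnfolding.UnfoldedLogStokesNegative
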